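import Mathlib.GroupTheory.Solvable
import Mathlib.GroupTheory.Abelianization.Finite
import Mathlib.GroupTheory.SpecificGroups.Cyclic
import Mathlib.GroupTheory.QuotientGroup.Basic
import Mathlib.GroupTheory.Index
import Mathlib.Order.Atoms
import Mathlib.Data.SetLike.Fintype
import HarnessLib

/-!
# `IrreducibleOffSector`: a finite non-trivial solvable group has a normal subgroup of prime index
(crux stmt-Langlands-14329 `IrreducibilityBySelfDuality.IrreducibleOffSector`, line `Sketch`;
`--supports` file, pure group theory; continuation lead c7, BC-ascent package, stub W10)

Group-theoretic step of the SOLVABLE BASE-CHANGE ASCENT for the crux "cuspidal `π` ⇒ every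
compatible `ρ` irreducible": irreducibility of `ρ : Γ_K → GL_n` ascends along a cyclic Galois
extension `L/K` of prime degree not dividing `n` (Clifford), and then along a solvable Galois
extension of degree prime to `n` by induction through a tower of cyclic prime-degree steps.  The
tower comes from the present file: a finite non-trivial solvable group `G` has a normal subgroup
`N` of prime index (then `L^N/K` is cyclic of prime degree and one recurses into
`Gal(L/L^N) = N`).

* `isSimpleGroup_quotient_of_isCoatom` — the quotient of a commutative group by a maximal subgroup
  is a simple group;
* `exists_normal_prime_index_of_isSolvable` — a finite non-trivial solvable group has a normal
  subgroup of prime index.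

Proof: `G' = commutator G < ⊤` (`IsSolvable.commutator_lt_top_of_nontrivial`), so the
abelianization `A = G ⧸ G'` is a finite non-trivial commutative group; its (finite) subgroup
lattice has a coatom `M`, the quotient `A ⧸ M` is a simple commutative group, hence of prime order
(`IsSimpleGroup.prime_card`), and the preimage `N` of `M` in `G` is normal of index
`[A : M] = |A ⧸ M|`.

References: folklore (e.g. D. J. S. Robinson, *A course in the theory of groups* (1996), 5.4.8 and
its proof).
-/

noncomputable section

-- `Summit.Langlands.Langlands.…` (summit = sub-problem name, D-0017 layout) trips `dupNamespace`
set_option linter.dupNamespace false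

namespace Summit.Langlands.Langlands.Theorems.IrreducibleOffSector

/-- **The quotient of a commutative group by a maximal subgroup is simple.**  If `M` is a coatom of
the subgroup lattice of a commutative group `A` (`M ≠ ⊤` and no subgroup lies strictly between `M`
and `⊤`), then `A ⧸ M` is a simple group: it is non-trivial as `M ≠ ⊤`, and the preimage in `A` of
a subgroup `H` of `A ⧸ M` contains `M`, so it is either `M` (and then `H = ⊥`) or `⊤` (and then
`H = ⊤`). [folklore] -/
theorem isSimpleGroup_quotient_of_isCoatom {A : Type*} [CommGroup A] {M : Subgroup A}
    (hM : IsCoatom M) : IsSimpleGroup (A ⧸ M) := by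
  haveI : Nontrivial (A ⧸ M) :=
    not_subsingleton_iff_nontrivial.mp fun h =>
      hM.1 (QuotientGroup.subgroup_eq_top_of_subsingleton M h)
  refine ⟨fun H _ => ?_⟩
  rcases (QuotientGroup.le_comap_mk' M H).eq_or_lt with h | h
  · left
    rw [← Subgroup.map_comap_eq_self_of_surjective (QuotientGroup.mk'_surjective M) H, ← h,
      QuotientGroup.map_mk'_self]
  · right
    have hK := hM.2 _ h
    rwa [← Subgroup.comap_top (QuotientGroup.mk' M),
      (Subgroup.comap_injective (QuotientGroup.mk'_surjective M)).eq_iff] at hK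

/-- **A finite non-trivial solvable group has a normal subgroup of prime index.**  Let `G` be a
finite non-trivial solvable group.  Then there is a normal subgroup `N ◁ G` whose index `[G : N]`
is a prime number.  (The derived subgroup `G'` is proper by solvability, so the abelianization
`A = G ⧸ G'` is a finite non-trivial commutative group; a maximal subgroup `M` of `A` has simple
commutative quotient `A ⧸ M`, hence of prime order, and `N` is the preimage of `M` in `G`, of index
`[A : M] = |A ⧸ M|`.) [folklore] -/
theorem exists_normal_prime_index_of_isSolvable {G : Type*} [Group G] [Finite G] [Nontrivial G]
    [IsSolvable G] : ∃ N : Subgroup G, N.Normal ∧ N.index.Prime := by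
  -- the abelianization `A = G ⧸ G'` is non-trivial since `G' < ⊤`
  have hlt : commutator G < ⊤ := IsSolvable.commutator_lt_top_of_nontrivial G
  haveI : Nontrivial (Abelianization G) :=
    not_subsingleton_iff_nontrivial.mp fun h =>
      hlt.ne (QuotientGroup.subgroup_eq_top_of_subsingleton (commutator G) h)
  -- a maximal subgroup `M` of the finite non-trivial commutative group `A`; `A ⧸ M` is simple
  obtain ⟨M, hM⟩ := IsCoatomic.exists_coatom (Subgroup (Abelianization G))
  haveI : IsSimpleGroup (Abelianization G ⧸ M) := isSimpleGroup_quotient_of_isCoatom hM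
  -- `N := M.comap (G → A)` is normal of index `[A : M] = |A ⧸ M|`, a prime
  have hsurj : Function.Surjective (Abelianization.of : G →* Abelianization G) :=
    QuotientGroup.mk_surjective
  refine ⟨M.comap Abelianization.of, inferInstance, ?_⟩
  rw [Subgroup.index_comap_of_surjective M hsurj, Subgroup.index_eq_card]
  exact IsSimpleGroup.prime_card

end Summit.Langlands.Langlands.Theorems.IrreducibleOffSector

end
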